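import Summits.CriticalPhenomena.PercolationContinuityZ3.Theorems.PercLowPointHalfSpaceTallClusterMassBoundWallArmLowerRegularity

/-!
# `TallClusterMassBound` (stmt-CriticalPhenomena-0912), line `onesided-halves` — stub D is uniform wall-arm doubling

Stub D (`stub_wallArmPolyRegular`) of the skeleton `Cruxes/TallClusterMassBound/Lines/onesided_halves.lean` reads
`∃ C μ, ∀ 1 ≤ ρ ≤ r, π_s(ρ) ≤ C (r/ρ)^μ π_s(r)` (`π_s(n) = armProb p_c n = P_{p_c}(arm_ℍ(0,n))`, the wall one-arm
probability of critical bond percolation on the half-space of `ℤ³`). This file proves, sorry-free, that D is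
EQUIVALENT to uniform doubling with SOME constant,

  `wallArmPolyRegular_iff_doubling : D ↔ ∃ q₀ > 0, ∀ n ≥ 1, q₀ π_s(n) ≤ π_s(2n)`,

so that the planner may file the promoted item in either spelling (the doubling form is the 3D wall analogue of
Kesten 1986 display (6) `π_{2n} ≥ C₃ π_n`, constant-free). Direction `→` is `ReplicaOverlap.doubling_of_wallArmLowerRegularity`
(p82448's file, whose hypothesis is exactly D's body); direction `←` (`wallArmPolyRegular_of_doubling`) iterates the doubling
along dyadic scales (`ReplicaOverlap.armProb_pow_mul_ge`) and uses that `π_s` is non-increasing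
(`ReplicaOverlap.armProb_le_armProb_of_le`): with `μ = log₂(1/q₀) ≥ 0` and `2^j ≤ r/ρ < 2^{j+1}`,
`π_s(ρ) ≤ q₀^{-(j+1)} π_s(2^{j+1}ρ) ≤ q₀⁻¹ (2^j)^μ π_s(r) ≤ q₀⁻¹ (r/ρ)^μ π_s(r)`.
No criticality is used beyond `π_s(n) > 0` (`armProb_criticalProbI_pos`); no definitions.
-/

noncomputable section

open MeasureTheory Finset Filter
open Literature.Probability.Percolation Literature.Probability.LatticeModels
open Summit.CriticalPhenomena.PercolationContinuityZ3.Theorems.TallClusterMassBound.Negative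
open Summit.CriticalPhenomena.PercolationContinuityZ3.Theorems.TallClusterMassBound.ReplicaOverlap

namespace Summit.CriticalPhenomena.PercolationContinuityZ3.Theorems.TallClusterMassBound.OnesidedHalves

/-- **Uniform doubling ⟹ D.** If `q₀ π_s(n) ≤ π_s(2n)` for all `n ≥ 1` with some `q₀ > 0`, then
`π_s(ρ) ≤ q₀⁻¹ (r/ρ)^{log₂(1/q₀)} π_s(r)` for all `1 ≤ ρ ≤ r`. [folklore] -/
theorem wallArmPolyRegular_of_doubling {q₀ : ℝ} (hq0 : 0 < q₀)
    (h : ∀ n : ℕ, 1 ≤ n → q₀ * armProb (criticalProbI 3) n ≤ armProb (criticalProbI 3) (2 * n)) :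
    ∀ ρ r : ℕ, 1 ≤ ρ → ρ ≤ r →
      armProb (criticalProbI 3) ρ ≤
        q₀⁻¹ * ((r : ℝ) / ρ) ^ (Real.logb 2 q₀⁻¹) * armProb (criticalProbI 3) r := by
  set p : unitInterval := criticalProbI 3 with hp
  -- q₀ ≤ 1, since π(2) ≤ π(1) and π(1) > 0
  have hq1 : q₀ ≤ 1 := by
    have h1 := h 1 le_rfl
    have h2 : armProb p (2 * 1) ≤ armProb p 1 := armProb_le_armProb_of_le p (by omega)
    have hπ : 0 < armProb p 1 := armProb_criticalProbI_pos 1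
    nlinarith
  set lam : ℝ := Real.logb 2 q₀⁻¹ with hlam
  have hqinv1 : 1 ≤ q₀⁻¹ := one_le_inv_iff₀.2 ⟨hq0, hq1⟩
  have hlam0 : 0 ≤ lam := Real.logb_nonneg (by norm_num) hqinv1
  have h2lam : (2 : ℝ) ^ lam = q₀⁻¹ := by
    rw [hlam, Real.rpow_logb (by norm_num) (by norm_num) (inv_pos.2 hq0)]
  intro ρ r hρ hρr
  have hρpos : 0 < ρ := hρ
  have hρ0 : (0 : ℝ) < ρ := by exact_mod_cast hρ
  set j : ℕ := Nat.log 2 (r / ρ) with hj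
  have hj1 : 2 ^ j ≤ r / ρ := Nat.pow_log_le_self 2 (by
    have : 1 ≤ r / ρ := (Nat.le_div_iff_mul_le hρpos).2 (by simpa using hρr)
    omega)
  have hj2 : r / ρ < 2 ^ (j + 1) := Nat.lt_pow_succ_log_self (by norm_num) _
  have hr_lt : r < 2 ^ (j + 1) * ρ := by
    have := (Nat.div_lt_iff_lt_mul hρpos).1 hj2
    linarith [Nat.mul_comm (2 ^ (j + 1)) ρ]
  -- π(r) ≥ π(2^{j+1} ρ) ≥ q₀^{j+1} π(ρ)
  have hchain : q₀ ^ (j + 1) * armProb p ρ ≤ armProb p r :=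
    le_trans (armProb_pow_mul_ge hq0.le (b := 2) (n₀ := 1) (by norm_num) h (j + 1) ρ hρ)
      (armProb_le_armProb_of_le p hr_lt.le)
  -- (q₀⁻¹)^j = (2^j)^lam ≤ (r/ρ)^lam
  have hpowj : (q₀⁻¹) ^ j = ((2 : ℝ) ^ j) ^ lam := by
    rw [← h2lam, ← Real.rpow_natCast ((2 : ℝ) ^ lam) j, ← Real.rpow_mul (by norm_num),
      mul_comm, Real.rpow_mul (by norm_num), Real.rpow_natCast]
  have hbj_le : ((2 : ℝ) ^ j) ≤ (r : ℝ) / ρ := by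
    have h1 : ((2 ^ j : ℕ) : ℝ) ≤ ((r / ρ : ℕ) : ℝ) := by exact_mod_cast hj1
    have h2 : ((r / ρ : ℕ) : ℝ) ≤ (r : ℝ) / ρ := Nat.cast_div_le
    push_cast at h1
    exact h1.trans h2
  have hfac : (q₀⁻¹) ^ j ≤ ((r : ℝ) / ρ) ^ lam := by
    rw [hpowj]
    exact Real.rpow_le_rpow (by positivity) hbj_le hlam0
  have hπr := armProb_nonneg p r
  have hqj0 : 0 < q₀ ^ (j + 1) := pow_pos hq0 _
  calc armProb p ρ = (q₀ ^ (j + 1))⁻¹ * (q₀ ^ (j + 1) * armProb p ρ) := by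
        field_simp
    _ ≤ (q₀ ^ (j + 1))⁻¹ * armProb p r := mul_le_mul_of_nonneg_left hchain (by positivity)
    _ = q₀⁻¹ * (q₀⁻¹) ^ j * armProb p r := by rw [← inv_pow, pow_succ]; ring
    _ ≤ q₀⁻¹ * ((r : ℝ) / ρ) ^ lam * armProb p r := by
        have hqi0 : 0 ≤ q₀⁻¹ := by positivity
        exact mul_le_mul_of_nonneg_right (mul_le_mul_of_nonneg_left hfac hqi0) hπr

/-- **Stub D ⟺ uniform wall-arm doubling with SOME constant.** The registered stub `stub_wallArmPolyRegular`
of line `onesided-halves` (`∃ C μ, ∀ 1 ≤ ρ ≤ r, π_s(ρ) ≤ C (r/ρ)^μ π_s(r)` at `p_c(ℤ³)`) holds iff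
`∃ q₀ > 0, ∀ n ≥ 1, q₀ π_s(n) ≤ π_s(2n)` (Kesten 1986 display (6) on the wall of `ℤ³`, constant-free). [folklore] -/
theorem wallArmPolyRegular_iff_doubling :
    (∃ C μ : ℝ, ∀ ρ r : ℕ, 1 ≤ ρ → ρ ≤ r →
      armProb (criticalProbI 3) ρ ≤ C * ((r : ℝ) / ρ) ^ μ * armProb (criticalProbI 3) r) ↔
    (∃ q₀ : ℝ, 0 < q₀ ∧ ∀ n : ℕ, 1 ≤ n →
      q₀ * armProb (criticalProbI 3) n ≤ armProb (criticalProbI 3) (2 * n)) := by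
  constructor
  · rintro ⟨C, μ, hW⟩
    exact doubling_of_wallArmLowerRegularity hW
  · rintro ⟨q₀, hq0, h⟩
    exact ⟨q₀⁻¹, Real.logb 2 q₀⁻¹, wallArmPolyRegular_of_doubling hq0 h⟩

end Summit.CriticalPhenomena.PercolationContinuityZ3.Theorems.TallClusterMassBound.OnesidedHalves

end
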